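import Summits.QuantumFields.YangMills.Theorems.UnitScaleTiltProp7TentQuasiInterpolantGrad
import HarnessLib

/-!
# Route `UnitScaleTilt`, crux K1 «MinimiserStabilityRegPr» (stmt-QuantumFields-19200) — route-R E′ (A′), LANE II «DIVERGENCE RECOVERY AT CURVED `W`» (★★OWNER RULING №23),
# brick (B2a), sub-pen F4 (★p1 g19 NAMER WORD №6 (3)), FILE F4-B3: **THE REPRODUCTION ROW OF THE COVARIANT TENT QUASI-INTERPOLANT AT THE MEMBER** — `‖w − Q′_W(I w)‖♮²` against the
# one-bond currency

Cell `ym3-torus` ∕ width seat `ym3-torus-px3` (gen 6).  THEOREMS ONLY (0 `def`, 0 `sorry`); `--supports stmt-QuantumFields-19200 --as helper`, count-neutral.  YM₃ on T³ is a ladder rung (R3),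
not d = 4, not the Clay problem; nothing here claims [Balaban1985BackgroundPropagators] Thm 3.11, `hN06`, (REC), E′, EX or the gap.

THE ROW.  For a coarse function `q` given by print's comb average (3.19) of the tent — `q y = Σ_{x ∈ box y} ((Lᵈ)⁻¹)ᵏ • Ad(τ_W(y, x)) (Σ_δ Θ(Y x − δ, x) • Ad(σ_{Y x−δ}(x))⁻¹ w(Y x − δ))`, i.e.
`q = Q′_W(I w)` by ✓`exists_tentQuasiInterpolant_core`'s averaging identity — and the member rows (FAT) `θ₂` (as in F4-B2) and (REP) `‖τ_W(Y, x)·σ_Y(x)⁻¹ − 1‖ ≤ θ₃`, `τ_W ∈ U1` (px5 g6's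
✓`norm_compT_bgT_sub_axialFn_le` read at the member by px15 g5): `Σ_y ‖w y − q y‖² ≤ 384·Σ_c ‖Ad(T c) w(c₊) − w(c₋)‖² + 512(θ₂ + θ₃)²·Σ_y ‖w y‖²`
(per box ✓`Prop7CovariantTentPointwise.norm_sq_sub_avg_covTent_le`; then ✓`sum_sum_norm_sq_conjR_holT_treeWord_inv_le` and translation invariance on the coarse torus).

CONTENTS (ns `…Theorems.Prop7TentQuasiInterpolantRep`): ★★★ `sum_norm_sq_sub_avg_tent_le`.
HONEST SCOPE.  Bookkeeping over landed lemmas; the frame rows are HYPOTHESES here; nothing of print estimated; rung R3, not Clay; YM gap NOT proved.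

References: T. Bałaban, CMP **99** (1985) 389–434 [Balaban1985BackgroundPropagators] ((3.17)–(3.19) p.393); CMP **98** (1985) 17–51 [Balaban1985Averaging] ((52)–(53) p.27, pp.24–25).
-/

set_option autoImplicit false

noncomputable section

open scoped InnerProductSpace Matrix.Norms.L2Operator BigOperators

namespace Summit.QuantumFields.YangMills.Theorems.Prop7TentQuasiInterpolantRep

open Literature.MathematicalPhysics.QuantumFieldTheory.Balaban1983to89
open Literature.MathematicalPhysics.QuantumFieldTheory.Balaban1983to89.T3ContinuumYM3Torus
open Literature.MathematicalPhysics.QuantumLattice (blockMap blockBase)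
open B7Prop1Explicit renaming Site → LSite
open B7Prop1Explicit (U1 axialFn axialFn_mem e treeWord hol_mem)
open B7Eq78Linearization (conjR conjR_apply)
open B8Eq119TwistedAxial (bgT)
open B9B8AveragingKernelZd (blockIter mem_blockIter_iff compT card_blockIter)
open B9Eq325QprimeSingleSiteZd (blockMapIter_eq_blockMap_pow)
open B9Thm31GpAgmonDecayCoarseZd (blockMapIter_eq_iterate)
open B10Eq27TorusAxialLog (transl transl_apply pull holT hol_pull_zero)
open T4TermwiseTorus (tcls tlift tcls_tlift tcls_apply)
open T3SectALandauChart (bgUnits)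
open Summit.QuantumFields.YangMills.Theorems.Prop7SPrint (basePt)
open Summit.QuantumFields.YangMills.Theorems.Prop7QprimeCombBumpSection (iterate_blockMap_of_mem_blockIter)
open Summit.QuantumFields.YangMills.Theorems.Prop7QprimeCombBumpSectionRows (pull_bgUnits_mem_U1)
open Summit.QuantumFields.YangMills.Theorems.Prop7CovariantTentPointwise (norm_sq_sub_avg_covTent_le)
open Summit.QuantumFields.YangMills.Theorems.Prop7TentWeightsZd (tensorTent_nonneg tensorTent_le_one sum_tensorTent_boxes_eq_one)
open Summit.QuantumFields.YangMills.Theorems.Prop7CoarseStaircaseTelescoping (sum_comp_transl_eq sum_sum_norm_sq_conjR_holT_treeWord_inv_le)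

section Member

variable (F : T3Family) (n K : ℕ)

/-- ★★★ **THE REPRODUCTION ROW OF THE COVARIANT TENT QUASI-INTERPOLANT.**  [cite: Balaban1985BackgroundPropagators, (3.17)-(3.19) p.393; Balaban1985Averaging, (52)-(53) p.27, pp.24-25] -/
theorem sum_norm_sq_sub_avg_tent_le (W : GaugeField (F.P K) 0 (Matrix.specialUnitaryGroup (Fin 2) ℂ))
    (T : PBond (F.P K) (K - n) → (Matrix (Fin 2) (Fin 2) ℂ)ˣ) (hT : ∀ c, T c ∈ U1 (Matrix (Fin 2) (Fin 2) ℂ)) {θ₂ θ₃ : ℝ} (hθ : 0 ≤ θ₂ + θ₃)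
    (hfat : ∀ (z : LSite (F.P K).d) (δ : Fin (F.P K).d → Fin 2),
      ‖((axialFn (pull (bgUnits F K W) (basePt F n K)) (blockBase ((F.P K).L ^ (K - n)) ((blockMap (F.P K).L)^[K - n] z)) z
          * (axialFn (pull (bgUnits F K W) (basePt F n K)) (blockBase ((F.P K).L ^ (K - n)) ((blockMap (F.P K).L)^[K - n] z - fun i => ((δ i : ℕ) : ℤ))) z)⁻¹ :
            (Matrix (Fin 2) (Fin 2) ℂ)ˣ) : Matrix (Fin 2) (Fin 2) ℂ)
        - (((holT T (tcls ((F.P K).sitesPerDir (K - n)) ((blockMap (F.P K).L)^[K - n] z - fun i => ((δ i : ℕ) : ℤ))) (treeWord (fun i => ((δ i : ℕ) : ℤ))))⁻¹ :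
            (Matrix (Fin 2) (Fin 2) ℂ)ˣ) : Matrix (Fin 2) (Fin 2) ℂ)‖ ≤ θ₂)
    (hrepU : ∀ (Y z : LSite (F.P K).d), z ∈ blockIter (F.P K).L (K - n) Y →
      compT (F.P K).L (bgT (F.P K).L (pull (bgUnits F K W) (basePt F n K))) (K - n) Y z ∈ U1 (Matrix (Fin 2) (Fin 2) ℂ))
    (hrep : ∀ (Y z : LSite (F.P K).d), z ∈ blockIter (F.P K).L (K - n) Y →
      ‖((compT (F.P K).L (bgT (F.P K).L (pull (bgUnits F K W) (basePt F n K))) (K - n) Y z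
          * (axialFn (pull (bgUnits F K W) (basePt F n K)) (blockBase ((F.P K).L ^ (K - n)) Y) z)⁻¹ : (Matrix (Fin 2) (Fin 2) ℂ)ˣ) : Matrix (Fin 2) (Fin 2) ℂ) - 1‖ ≤ θ₃)
    (w q : Site (F.P K) (K - n) → Matrix (Fin 2) (Fin 2) ℂ)
    (hq : ∀ y : Site (F.P K) (K - n), q y
      = ∑ x ∈ blockIter (F.P K).L (K - n) (tlift y),
          ((((F.P K).L : ℝ) ^ (F.P K).d)⁻¹) ^ (K - n) •
            conjR (compT (F.P K).L (bgT (F.P K).L (pull (bgUnits F K W) (basePt F n K))) (K - n) (tlift y) x)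
              (∑ δ : Fin (F.P K).d → Fin 2,
                (∏ i : Fin (F.P K).d, max 0 (1 - |((x i - ((F.P K).L ^ (K - n) : ℕ) * (((blockMap (F.P K).L)^[K - n] x - fun i => ((δ i : ℕ) : ℤ)) i) : ℤ) : ℝ)
                    - (((F.P K).L ^ (K - n) : ℕ) : ℝ)| / (((F.P K).L ^ (K - n) : ℕ) : ℝ))) •
                  conjR (axialFn (pull (bgUnits F K W) (basePt F n K)) (blockBase ((F.P K).L ^ (K - n)) ((blockMap (F.P K).L)^[K - n] x - fun i => ((δ i : ℕ) : ℤ))) x)⁻¹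
                    (w (tcls ((F.P K).sitesPerDir (K - n)) ((blockMap (F.P K).L)^[K - n] x - fun i => ((δ i : ℕ) : ℤ)))))) :
    ∑ y : Site (F.P K) (K - n), ‖w y - q y‖ ^ 2
      ≤ 384 * ∑ c : PBond (F.P K) (K - n), ‖conjR (T c) (w (c.src.shift c.dir)) - w c.src‖ ^ 2
        + 512 * (θ₂ + θ₃) ^ 2 * ∑ y : Site (F.P K) (K - n), ‖w y‖ ^ 2 := by
  haveI : NeZero (F.P K).L := ⟨by have h := F.hL.2; show F.L ≠ 0; omega⟩
  set Nk : ℕ := (F.P K).sitesPerDir (K - n) with hNk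
  set ℓ : ℕ := (F.P K).L ^ (K - n) with hℓ
  have hℓpos : 0 < ℓ := pos_iff_ne_zero.mpr (pow_ne_zero _ (NeZero.ne _))
  have hit : ∀ x : LSite (F.P K).d, (blockMap (F.P K).L)^[K - n] x = blockMap ℓ x := fun x => by
    rw [← blockMapIter_eq_iterate (F.P K).L (K - n) x, blockMapIter_eq_blockMap_pow]
  set V := pull (bgUnits F K W) (basePt F n K) with hVdef
  have hV : ∀ x κ, V x κ ∈ U1 (Matrix (Fin 2) (Fin 2) ℂ) := fun x κ => pull_bgUnits_mem_U1 W (basePt F n K) x κ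
  have hd : (F.P K).d = 3 := T3Family.P_d F K
  have hd3 : (((F.P K).d : ℕ) : ℝ) = 3 := by exact_mod_cast hd
  have h2d' : (2 : ℝ) ^ (F.P K).d = 8 := by rw [hd]; norm_num
  have hcardR : (((Finset.univ : Finset (Fin (F.P K).d → Fin 2)).card : ℕ) : ℝ) = 8 := by
    rw [Finset.card_univ, Fintype.card_fun, Fintype.card_fin, Fintype.card_fin]; push_cast; rw [h2d']
  -- the coarse-site functions `E`, `M`
  set E : Site (F.P K) (K - n) → ℝ := fun y => ∑ δ : Fin (F.P K).d → Fin 2,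
    ‖conjR (holT T (transl y (-fun i => ((δ i : ℕ) : ℤ))) (treeWord (fun i => ((δ i : ℕ) : ℤ))))⁻¹ (w (transl y (-fun i => ((δ i : ℕ) : ℤ)))) - w y‖ ^ 2 with hE
  set M : Site (F.P K) (K - n) → ℝ := fun y => ∑ δ : Fin (F.P K).d → Fin 2, ‖w (transl y (-fun i => ((δ i : ℕ) : ℤ)))‖ ^ 2 with hM
  have htr : ∀ (y : Site (F.P K) (K - n)) (δ : Fin (F.P K).d → Fin 2), tcls Nk (tlift y - fun i => ((δ i : ℕ) : ℤ)) = transl y (-fun i => ((δ i : ℕ) : ℤ)) := by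
    intro y δ
    have hy : tcls Nk (tlift y) = y := tcls_tlift y
    funext ν
    have hyν := congrFun hy ν
    simp only [tcls_apply] at hyν
    simp only [transl_apply, tcls_apply, Pi.sub_apply, Pi.neg_apply]; push_cast; rw [hyν]; ring
  -- per coarse site
  have hbox : ∀ y : Site (F.P K) (K - n), ‖w y - q y‖ ^ 2 ≤ 2 * 8 * E y + 8 * 8 * (θ₂ + θ₃) ^ 2 * M y := by
    intro y
    set Y : LSite (F.P K).d := tlift y with hYdef
    have hwy : w y = w (tcls Nk (Y - fun _ : Fin (F.P K).d => (((0 : Fin 2) : ℕ) : ℤ))) := by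
      rw [show (Y - fun _ : Fin (F.P K).d => (((0 : Fin 2) : ℕ) : ℤ)) = Y from funext fun i => sub_zero (Y i), hYdef, tcls_tlift]
    -- rewrite `q y` with the box label `Y` in place of `⌊x⌋^[k]`
    have hqY : q y = ∑ x ∈ blockIter (F.P K).L (K - n) Y,
        ((((F.P K).L : ℝ) ^ (F.P K).d)⁻¹) ^ (K - n) •
          conjR (compT (F.P K).L (bgT (F.P K).L V) (K - n) Y x)
            (∑ δ : Fin (F.P K).d → Fin 2,
              (∏ i : Fin (F.P K).d, max 0 (1 - |((x i - (ℓ : ℕ) * ((Y - fun i => ((δ i : ℕ) : ℤ)) i) : ℤ) : ℝ) - ((ℓ : ℕ) : ℝ)| / ((ℓ : ℕ) : ℝ))) •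
                conjR (axialFn V (blockBase ℓ (Y - fun i => ((δ i : ℕ) : ℤ))) x)⁻¹ (w (tcls Nk (Y - fun i => ((δ i : ℕ) : ℤ))))) := by
      rw [hq y]
      refine Finset.sum_congr rfl fun x hx => ?_
      rw [iterate_blockMap_of_mem_blockIter (F.P K).L hx]
    rw [hwy, hqY]
    have hY1 : ∀ x ∈ blockIter (F.P K).L (K - n) Y, blockMap ℓ x = Y := fun x hx => by rw [← hit]; exact iterate_blockMap_of_mem_blockIter (F.P K).L hx
    have hω1 : ∑ x ∈ blockIter (F.P K).L (K - n) Y, ((((F.P K).L : ℝ) ^ (F.P K).d)⁻¹) ^ (K - n) = 1 := by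
      rw [Finset.sum_const, card_blockIter, nsmul_eq_mul]
      have hL0 : (((F.P K).L : ℝ) ^ (F.P K).d) ^ (K - n) ≠ 0 := by
        have : ((F.P K).L : ℝ) ≠ 0 := by exact_mod_cast NeZero.ne (F.P K).L
        positivity
      push_cast
      rw [inv_pow, mul_inv_cancel₀ hL0]
    have h := norm_sq_sub_avg_covTent_le (𝔸 := Matrix (Fin 2) (Fin 2) ℂ) (blockIter (F.P K).L (K - n) Y)
      (fun _ => ((((F.P K).L : ℝ) ^ (F.P K).d)⁻¹) ^ (K - n)) (fun _ _ => by positivity) hω1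
      (fun x => compT (F.P K).L (bgT (F.P K).L V) (K - n) Y x) (fun x hx => hrepU Y x hx)
      (Finset.univ : Finset (Fin (F.P K).d → Fin 2))
      (fun x δ => ∏ i : Fin (F.P K).d, max 0 (1 - |((x i - (ℓ : ℕ) * ((Y - fun i => ((δ i : ℕ) : ℤ)) i) : ℤ) : ℝ) - ((ℓ : ℕ) : ℝ)| / ((ℓ : ℕ) : ℝ)))
      (fun x _ δ _ => tensorTent_nonneg ℓ _) (fun x _ δ _ => tensorTent_le_one ℓ _)
      (fun x hx => by have h1 := sum_tensorTent_boxes_eq_one hℓpos x; rw [hY1 x hx] at h1; exact h1)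
      (fun δ x => axialFn V (blockBase ℓ (Y - fun i => ((δ i : ℕ) : ℤ))) x) (fun δ _ x _ => axialFn_mem hV _ _)
      (fun _ => 0) (fun x _ => axialFn_mem hV _ _)
      (fun δ => (holT T (tcls Nk (Y - fun i => ((δ i : ℕ) : ℤ))) (treeWord (fun i => ((δ i : ℕ) : ℤ))))⁻¹)
      (fun δ _ => (U1 _).inv_mem (by rw [← hol_pull_zero]; exact hol_mem (fun z κ => hT _) _ _))
      (θ₂ := θ₂) (θ₃ := θ₃) hθ
      (fun x hx => by
        have h1 := hrep Y x hx
        have h0 : (Y - fun _ : Fin (F.P K).d => (((0 : Fin 2) : ℕ) : ℤ)) = Y := funext fun i => sub_zero (Y i)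
        simp only [h0]
        exact h1)
      (fun x hx δ _ => by
        have h1 := hfat x δ
        rw [hit, hY1 x hx] at h1
        have h0 : (Y - fun _ : Fin (F.P K).d => (((0 : Fin 2) : ℕ) : ℤ)) = Y := funext fun i => sub_zero (Y i)
        simp only [h0]
        exact h1)
      (fun δ => w (tcls Nk (Y - fun i => ((δ i : ℕ) : ℤ))))
    beta_reduce at h
    rw [hcardR] at h
    refine h.trans (le_of_eq ?_)
    have hEy : ∑ δ : Fin (F.P K).d → Fin 2, ‖conjR (holT T (tcls Nk (Y - fun i => ((δ i : ℕ) : ℤ))) (treeWord (fun i => ((δ i : ℕ) : ℤ))))⁻¹ (w (tcls Nk (Y - fun i => ((δ i : ℕ) : ℤ))))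
        - w (tcls Nk (Y - fun _ : Fin (F.P K).d => (((0 : Fin 2) : ℕ) : ℤ)))‖ ^ 2 = E y := by
      rw [← hwy, hE]
      refine Finset.sum_congr rfl fun δ _ => ?_
      rw [hYdef, htr]
    have hMy : ∑ δ : Fin (F.P K).d → Fin 2, ‖w (tcls Nk (Y - fun i => ((δ i : ℕ) : ℤ)))‖ ^ 2 = M y := by
      rw [hM]
      refine Finset.sum_congr rfl fun δ _ => ?_
      rw [hYdef, htr]
    rw [hEy, hMy]
  -- sum over the coarse torus
  have hEsum : ∑ y : Site (F.P K) (K - n), E y ≤ 24 * ∑ c : PBond (F.P K) (K - n), ‖conjR (T c) (w (c.src.shift c.dir)) - w c.src‖ ^ 2 := by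
    have h := sum_sum_norm_sq_conjR_holT_treeWord_inv_le T hT w
    rw [h2d', hd3] at h
    refine (le_of_eq ?_).trans (h.trans (le_of_eq (by norm_num)))
    rw [hE]
  have hMsum : ∑ y : Site (F.P K) (K - n), M y = 8 * ∑ y : Site (F.P K) (K - n), ‖w y‖ ^ 2 := by
    rw [hM, Finset.sum_comm]
    rw [Finset.sum_congr rfl fun δ _ => sum_comp_transl_eq (-fun i => ((δ i : ℕ) : ℤ)) (fun y => ‖w y‖ ^ 2), Finset.sum_const, Finset.card_univ, nsmul_eq_mul,
      Fintype.card_fun, Fintype.card_fin, Fintype.card_fin]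
    push_cast
    rw [h2d']
  calc ∑ y : Site (F.P K) (K - n), ‖w y - q y‖ ^ 2 ≤ ∑ y : Site (F.P K) (K - n), (2 * 8 * E y + 8 * 8 * (θ₂ + θ₃) ^ 2 * M y) := Finset.sum_le_sum fun y _ => hbox y
    _ = 16 * ∑ y : Site (F.P K) (K - n), E y + 64 * (θ₂ + θ₃) ^ 2 * ∑ y : Site (F.P K) (K - n), M y := by
        rw [Finset.sum_add_distrib, Finset.mul_sum, Finset.mul_sum]
        congr 1 <;> refine Finset.sum_congr rfl fun y _ => ?_ <;> ring
    _ ≤ 16 * (24 * ∑ c : PBond (F.P K) (K - n), ‖conjR (T c) (w (c.src.shift c.dir)) - w c.src‖ ^ 2) + 64 * (θ₂ + θ₃) ^ 2 * (8 * ∑ y : Site (F.P K) (K - n), ‖w y‖ ^ 2) := by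
        rw [hMsum]; gcongr
    _ = _ := by ring

end Member

end Summit.QuantumFields.YangMills.Theorems.Prop7TentQuasiInterpolantRep

end
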